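import Mathlib
import HarnessLib
import Summits.HubbardSuperconductivity.HubbardSuperconductivity.Theorems.KLProgrammeC4aTadpoleRepresentation
import Summits.HubbardSuperconductivity.HubbardSuperconductivity.Theorems.KLProgrammeKLRegimeTwoLegCurvatureDefs
import Summits.HubbardSuperconductivity.HubbardSuperconductivity.Theorems.KLProgrammeH10TwoPointLimitFrameFermiPoint

/-!
# Route `KLProgramme` — crux C4a, the (A)-closer's TRANSFER STEP: angular jets of an eight-image average are bounded by the jets of ONE function;
# `TwoLegCurveJetBound` at scale `n+1` from sup-bounds on the jets of `θ ↦ Re 𝒯(k_F^K θ)` (the continuum increment reading of `…C4aCharPolyReading`)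

Cell `gate-hubbard-kl`, lane hubbard-kl-c4a-1 (g5); helper for stub (C) `stub_twoLeg_curvature` of the engine-flow child `KLRegimeEngineV17F2`
(stmt-HubbardSuperconductivity-20437); memo HOME/hubbard-kl-c4a-1/C4A-PLAN.md §9/§16.  By `klLocalPart_succ_sub_eq_avg8` the curve profile
`δ_{n+1} = klTwoLegCurveProfile … K (n+1)` is the average of `F := θ ↦ Re 𝒯(k_F^K θ)` over the eight images `θ′ = ±θ + c`, `c ∈ {0, π, π/2, 3π/2}`;
differentiating an image costs a sign, so every angular jet of `δ_{n+1}` is bounded by the SAME jet of `F`, uniformly: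

* §1 `avg8 F` (def, the eight-image average in the literal shape of `…C4aCharPolyReading`), `avg8_eq_sum` (as a `Fin 8`-sum of `F(s_i θ + c_i)`, `s_i = ±1`),
  `iteratedDeriv_comp_affine` (`∂ʲ[F(sθ + c)] = sʲ·F⁽ʲ⁾(sθ + c)`), `contDiff_avg8`, **`iteratedDeriv_avg8`**, **`abs_iteratedDeriv_avg8_le`**
  (`|F⁽ʲ⁾| ≤ b` everywhere ⇒ `|∂ʲ(avg8 F)| ≤ b` everywhere);
* §2 **`twoLegCurveJetBound_of_avg8`** — if `δ_m = avg8 F` with `F ∈ C⁴` and `|F⁽ᵏ⁾| ≤ curveJetBar c c′ U k m` (`k ≤ 4`) then `TwoLegCurveJetBound L M c c′ β U μ K m`;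
* §3 `IsCharPoly.contDiff` (a canonical character polynomial is `C^∞` on `Fin 2 → ℝ`), **`IsCharPoly.contDiff_re_comp_klFermiPoint`** (under the band hypotheses
  `θ ↦ Re G(k_F^K θ)` is `C^∞`, `contDiff_klFermiPoint`), and the engine instance **`klTwoLegCurveProfile_succ_eq_avg8`**:
  `δ_{n+1}(K) = avg8 (θ ↦ Re[tadpoleCont + localReadingCont R₁ + localReadingCont R₂](k_F^K θ))` (`Z^K_{Λ_n} ≠ 0`; `localReadingCont_laplacian_klEffectiveAction`),
  so **`twoLegCurveJetBound_succ_of_jets`**: (A) at scale `n+1` follows from `C⁴`-ness and the four sup-jet bounds of that ONE function.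

Calculus + bookkeeping; the jet bounds of `F` are hypotheses (tube-jet theorem + (L3) for the one-line term, the `R₁/R₂` doors for the rest); nothing is asserted
about the Hubbard model's sizes; nothing asserts superconductivity.  References: BGM 2006 §2.4 (2.36)–(2.40) [cite: BenfattoGiulianiMastropietro2006].
-/

noncomputable section

namespace Summit.HubbardSuperconductivity.HubbardSuperconductivity.Theorems.C4a

set_option linter.dupNamespace false -- summit = problem name (single-conjunct summit), D-0017

open Real Finset
open scoped ContDiff
open Literature.MathematicalPhysics.QuantumLattice Literature.MathematicalPhysics.QuantumLattice.BandSectorCounting Literature.Probability.LatticeModels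
open GrassmannAlgebra
open Summit.HubbardSuperconductivity.HubbardSuperconductivity.Theorems.KLRegimeSplit
open Summit.HubbardSuperconductivity.HubbardSuperconductivity.Theorems.KLProgrammeLegKernels
open Summit.HubbardSuperconductivity.HubbardSuperconductivity.Theorems.KLRegimeWick
open Summit.HubbardSuperconductivity.HubbardSuperconductivity.Theorems.DispersionFlow
open Summit.HubbardSuperconductivity.HubbardSuperconductivity.Theorems.PerturbedFermiCurve

/-! ## §1 The eight-image average and its angular jets -/

/-- **The eight-image average** of an angular function: `⅛[F(θ) + F(θ+π) + F(−θ) + F(−θ+π) + F(π/2−θ) + F(π/2−θ+π) + F(π/2+θ) + F(π/2+θ+π)]` — the shape in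
which `…C4aCharPolyReading.klLocalPart_eq_avg8 / klLocalPart_succ_sub_eq_avg8` deliver the local part and its increment. -/
def avg8 (F : ℝ → ℝ) (θ : ℝ) : ℝ :=
  (F θ + F (θ + π) + (F (-θ) + F (-θ + π)) + (F (π / 2 - θ) + F (π / 2 - θ + π)) + (F (π / 2 + θ) + F (π / 2 + θ + π))) / 8

/-- The signs of the eight images (`+1`: rotations, `−1`: reflections). -/
def avg8Sign : Fin 8 → ℝ := ![1, 1, -1, -1, -1, -1, 1, 1]

/-- The shifts of the eight images. -/
def avg8Shift : Fin 8 → ℝ := ![0, π, 0, π, π / 2, π / 2 + π, π / 2, π / 2 + π]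

/-- Every sign is `±1`. -/
theorem abs_avg8Sign (i : Fin 8) : |avg8Sign i| = 1 := by
  fin_cases i <;> simp [avg8Sign]

/-- `avg8` as a `Fin 8`-sum of affine images. -/
theorem avg8_eq_sum (F : ℝ → ℝ) (θ : ℝ) : avg8 F θ = (∑ i : Fin 8, F (avg8Sign i * θ + avg8Shift i)) / 8 := by
  simp only [avg8, Fin.sum_univ_eight, avg8Sign, avg8Shift, Matrix.cons_val]
  simp only [one_mul, neg_one_mul, add_zero]
  rw [show -θ + π / 2 = π / 2 - θ by ring, show -θ + (π / 2 + π) = π / 2 - θ + π by ring, show θ + π / 2 = π / 2 + θ by ring,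
    show θ + (π / 2 + π) = π / 2 + θ + π by ring]
  ring

/-- `avg8` as a function, `Fin 8`-form. -/
theorem avg8_eq_sum_fun (F : ℝ → ℝ) : avg8 F = fun θ => (∑ i : Fin 8, F (avg8Sign i * θ + avg8Shift i)) / 8 :=
  funext (avg8_eq_sum F)

/-- **Jets of an affine image**: `∂ʲ[θ ↦ F(sθ + c)](θ) = sʲ·F⁽ʲ⁾(sθ + c)` for `F ∈ Cᴺ`, `j ≤ N`. -/
theorem iteratedDeriv_comp_affine {F : ℝ → ℝ} {N : ℕ∞} (hF : ContDiff ℝ N F) {j : ℕ} (hj : (j : ℕ∞) ≤ N) (s c θ : ℝ) :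
    iteratedDeriv j (fun θ : ℝ => F (s * θ + c)) θ = s ^ j * iteratedDeriv j F (s * θ + c) := by
  have hFc : ContDiff ℝ j (fun z : ℝ => F (z + c)) := (hF.of_le (by exact_mod_cast hj)).comp (contDiff_id.add contDiff_const)
  have h1 : (fun θ : ℝ => F (s * θ + c)) = fun θ : ℝ => (fun z : ℝ => F (z + c)) (s * θ) := rfl
  rw [h1, iteratedDeriv_comp_const_mul hFc s]
  simp only [iteratedDeriv_comp_add_const]

/-- An affine image of a `Cᴺ` function is `Cᴺ`. -/
theorem contDiff_comp_affine {F : ℝ → ℝ} {N : ℕ∞} (hF : ContDiff ℝ N F) (s c : ℝ) : ContDiff ℝ N fun θ : ℝ => F (s * θ + c) :=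
  hF.comp ((contDiff_const.mul contDiff_id).add contDiff_const)

/-- `avg8 F` is as smooth as `F`. -/
theorem contDiff_avg8 {F : ℝ → ℝ} {N : ℕ∞} (hF : ContDiff ℝ N F) : ContDiff ℝ N (avg8 F) := by
  rw [avg8_eq_sum_fun]
  exact (ContDiff.sum fun i _ => contDiff_comp_affine hF _ _).div_const _

/-- **JETS OF THE EIGHT-IMAGE AVERAGE**: `∂ʲ(avg8 F)(θ) = ⅛ Σ_i s_iʲ·F⁽ʲ⁾(s_iθ + c_i)` (`F ∈ Cᴺ`, `j ≤ N`). -/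
theorem iteratedDeriv_avg8 {F : ℝ → ℝ} {N : ℕ∞} (hF : ContDiff ℝ N F) {j : ℕ} (hj : (j : ℕ∞) ≤ N) (θ : ℝ) :
    iteratedDeriv j (avg8 F) θ = (∑ i : Fin 8, avg8Sign i ^ j * iteratedDeriv j F (avg8Sign i * θ + avg8Shift i)) / 8 := by
  rw [avg8_eq_sum_fun, iteratedDeriv_div_const, iteratedDeriv_fun_sum fun i _ =>
    ((contDiff_comp_affine hF _ _).of_le (by exact_mod_cast hj)).contDiffAt]
  simp_rw [iteratedDeriv_comp_affine hF hj]

/-- **TRANSFER OF SUP-JET BOUNDS**: if `|F⁽ʲ⁾(θ)| ≤ b` for all `θ` then `|∂ʲ(avg8 F)(θ)| ≤ b` for all `θ` (`F ∈ Cᴺ`, `j ≤ N`). -/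
theorem abs_iteratedDeriv_avg8_le {F : ℝ → ℝ} {N : ℕ∞} (hF : ContDiff ℝ N F) {j : ℕ} (hj : (j : ℕ∞) ≤ N) {b : ℝ}
    (hb : ∀ θ : ℝ, |iteratedDeriv j F θ| ≤ b) (θ : ℝ) : |iteratedDeriv j (avg8 F) θ| ≤ b := by
  rw [iteratedDeriv_avg8 hF hj, abs_div, abs_of_pos (by norm_num : (0 : ℝ) < 8), div_le_iff₀ (by norm_num : (0 : ℝ) < 8)]
  calc |∑ i : Fin 8, avg8Sign i ^ j * iteratedDeriv j F (avg8Sign i * θ + avg8Shift i)|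
      ≤ ∑ i : Fin 8, |avg8Sign i ^ j * iteratedDeriv j F (avg8Sign i * θ + avg8Shift i)| := Finset.abs_sum_le_sum_abs _ _
    _ ≤ ∑ _i : Fin 8, b := Finset.sum_le_sum fun i _ => by
        rw [abs_mul, abs_pow, abs_avg8Sign, one_pow, one_mul]
        exact hb _
    _ = b * 8 := by simp [mul_comm]

/-! ## §2 `TwoLegCurveJetBound` from the jets of one function -/

section Model

variable {L M : ℕ} [NeZero L] [NeZero M]

/-- **(A) FROM ONE FUNCTION.**  If the curve profile at scale `m` is an eight-image average, `δ_m = avg8 F`, of a `C⁴` function whose jets of order `k ≤ 4`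
are within the bars `curveJetBar c c′ U k m`, then `TwoLegCurveJetBound L M c c′ β U μ K m`. -/
theorem twoLegCurveJetBound_of_avg8 {c c' : ℕ → ℝ} {β U μ : ℝ} {K : TrigPolyC4v} {m : ℕ} {F : ℝ → ℝ}
    (hprof : ∀ θ : ℝ, klTwoLegCurveProfile L M β U μ K m θ = avg8 F θ) (hF : ContDiff ℝ 4 F)
    (hb : ∀ k ≤ 4, ∀ θ : ℝ, |iteratedDeriv k F θ| ≤ curveJetBar c c' U k m) : TwoLegCurveJetBound L M c c' β U μ K m := by
  have hfun : klTwoLegCurveProfile L M β U μ K m = avg8 F := funext hprof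
  refine ⟨?_, fun k hk θ => ?_⟩
  · rw [hfun]; exact contDiff_avg8 hF
  · rw [hfun]
    exact abs_iteratedDeriv_avg8_le hF (by exact_mod_cast hk) (hb k hk) θ

/-! ## §3 Smoothness of the continuum readings along the Fermi curve; the engine instance -/

/-- A canonical character polynomial is `C^∞` on `Fin 2 → ℝ` (a finite sum of plane waves). -/
theorem IsCharPoly.contDiff {G : (Fin 2 → ℝ) → ℂ} (hG : IsCharPoly L G) {N : ℕ∞} : ContDiff ℝ N G := by
  obtain ⟨cf, hcf⟩ := hG
  have hfun : G = fun P => ∑ z : TorusSite 2 L, cf z * Complex.exp (((∑ j, P j * ((z j).valMinAbs : ℝ) : ℝ) : ℂ) * Complex.I) := funext hcf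
  rw [hfun]
  refine ContDiff.sum fun z _ => contDiff_const.mul (Complex.contDiff_exp.comp ?_)
  have hs : ContDiff ℝ N (fun P : Fin 2 → ℝ => (∑ j, P j * ((z j).valMinAbs : ℝ) : ℝ)) :=
    ContDiff.sum fun j _ => ((contDiff_apply ℝ ℝ j).mul contDiff_const)
  exact (Complex.ofRealCLM.contDiff.comp hs).mul contDiff_const

section Band

variable {a b : ℝ} (B : BandBounds a b) {K : TrigPolyC4v} {A : ℝ}
  (hA : ∀ p : Momentum, ∀ j ≤ 2, ‖iteratedFDeriv ℝ j (frameShift K) p‖ ≤ A) (hADt : 2 * A < B.Dtmin)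
  {μ : ℝ} (hlo : a ≤ μ - A) (hhi : μ + A ≤ b)
include B hA hADt hlo hhi

/-- **Under the band hypotheses, `θ ↦ Re G(k_F^K θ)` is `C^∞`** for every canonical character polynomial `G` (the frame's Fermi point is `C^∞` in the angle,
`contDiff_klFermiPoint`). [cite: BenfattoGiulianiMastropietro2006, §2.4 Lemma 2.1 (2.40)] -/
theorem IsCharPoly.contDiff_re_comp_klFermiPoint {G : (Fin 2 → ℝ) → ℂ} (hG : IsCharPoly L G) {N : ℕ∞} :
    ContDiff ℝ N fun θ : ℝ => (G (klFermiPoint μ K θ)).re :=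
  Complex.reCLM.contDiff.comp (hG.contDiff.comp (contDiff_klFermiPoint B hA hADt hlo hhi))

omit B hA hADt hlo hhi in
/-- **THE ENGINE INSTANCE** (`β ≠ 0`, `Z^K_{Λ_n} ≠ 0`): the curve profile at scale `n+1` is the eight-image average of
`F := θ ↦ Re[tadpoleCont + localReadingCont(R₁) + localReadingCont(R₂)](k_F^K θ)` — `klLocalPart_succ_sub_eq_avg8` with the one-line term identified by
`localReadingCont_laplacian_klEffectiveAction`. -/
theorem klTwoLegCurveProfile_succ_eq_avg8 {β : ℝ} (hβ : β ≠ 0) (U : ℝ) (n : ℕ)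
    (hZ : hubbardEffPartitionFnCT L M β U μ 0 K (klScale klE0 n) ≠ 0) {T : (Fin 2 → ℝ) → ℂ}
    (hT : T = fun P =>
      tadpoleCont β μ K (klScale klE0 (n + 1)) (klScale klE0 n) (klEffectiveAction L M β U μ K klE0 n) P +
        localReadingCont β
          (gaussConv ℂ (hubbardCovSliceCT L M β μ 0 K (klScale klE0 (n + 1)) (klScale klE0 n)) (klEffectiveAction L M β U μ K klE0 n) -
            klEffectiveAction L M β U μ K klE0 n -
            grassmannLaplacian ℂ (hubbardCovSliceCT L M β μ 0 K (klScale klE0 (n + 1)) (klScale klE0 n))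
              (klEffectiveAction L M β U μ K klE0 n)) P +
        localReadingCont β
          (effAction ℂ (hubbardCovSliceCT L M β μ 0 K (klScale klE0 (n + 1)) (klScale klE0 n)) (klEffectiveAction L M β U μ K klE0 n) -
            gaussConv ℂ (hubbardCovSliceCT L M β μ 0 K (klScale klE0 (n + 1)) (klScale klE0 n)) (klEffectiveAction L M β U μ K klE0 n)) P)
    (θ : ℝ) :
    klTwoLegCurveProfile L M β U μ K (n + 1) θ = avg8 (fun θ' : ℝ => (T (klFermiPoint μ K θ')).re) θ := by
  have hT' : T = fun P =>
      localReadingCont β (grassmannLaplacian ℂ (hubbardCovSliceCT L M β μ 0 K (klScale klE0 (n + 1)) (klScale klE0 n))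
          (klEffectiveAction L M β U μ K klE0 n)) P +
        localReadingCont β
          (gaussConv ℂ (hubbardCovSliceCT L M β μ 0 K (klScale klE0 (n + 1)) (klScale klE0 n)) (klEffectiveAction L M β U μ K klE0 n) -
            klEffectiveAction L M β U μ K klE0 n -
            grassmannLaplacian ℂ (hubbardCovSliceCT L M β μ 0 K (klScale klE0 (n + 1)) (klScale klE0 n))
              (klEffectiveAction L M β U μ K klE0 n)) P +
        localReadingCont β
          (effAction ℂ (hubbardCovSliceCT L M β μ 0 K (klScale klE0 (n + 1)) (klScale klE0 n)) (klEffectiveAction L M β U μ K klE0 n) -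
            gaussConv ℂ (hubbardCovSliceCT L M β μ 0 K (klScale klE0 (n + 1)) (klScale klE0 n)) (klEffectiveAction L M β U μ K klE0 n)) P := by
    rw [hT]
    funext P
    rw [localReadingCont_laplacian_klEffectiveAction hβ]
  rw [klTwoLegCurveProfile_succ]
  exact klLocalPart_succ_sub_eq_avg8 hβ U μ K n hZ hT' θ

omit B hA hADt hlo hhi in
/-- The increment function of `klTwoLegCurveProfile_succ_eq_avg8` is a canonical character polynomial (hence `C^∞` along the Fermi curve). -/
theorem isCharPoly_incrCont (β U : ℝ) (n : ℕ) :
    IsCharPoly L fun P =>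
      tadpoleCont β μ K (klScale klE0 (n + 1)) (klScale klE0 n) (klEffectiveAction L M β U μ K klE0 n) P +
        localReadingCont β
          (gaussConv ℂ (hubbardCovSliceCT L M β μ 0 K (klScale klE0 (n + 1)) (klScale klE0 n)) (klEffectiveAction L M β U μ K klE0 n) -
            klEffectiveAction L M β U μ K klE0 n -
            grassmannLaplacian ℂ (hubbardCovSliceCT L M β μ 0 K (klScale klE0 (n + 1)) (klScale klE0 n))
              (klEffectiveAction L M β U μ K klE0 n)) P +
        localReadingCont β
          (effAction ℂ (hubbardCovSliceCT L M β μ 0 K (klScale klE0 (n + 1)) (klScale klE0 n)) (klEffectiveAction L M β U μ K klE0 n) -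
            gaussConv ℂ (hubbardCovSliceCT L M β μ 0 K (klScale klE0 (n + 1)) (klScale klE0 n)) (klEffectiveAction L M β U μ K klE0 n)) P :=
  ((isCharPoly_tadpoleCont β μ K _ _ _).add (isCharPoly_localReadingCont β _)).add (isCharPoly_localReadingCont β _)

/-- **(A) AT SCALE `n+1` FROM THE JETS OF ONE FUNCTION** (`β ≠ 0`, `Z^K_{Λ_n} ≠ 0`, band hypotheses at the frame `K`): with
`F θ = Re[tadpoleCont + localReadingCont(R₁) + localReadingCont(R₂)](k_F^K θ)` (automatically `C^∞`), the four sup-jet bounds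
`|F⁽ᵏ⁾| ≤ curveJetBar c c′ U k (n+1)` (`k ≤ 4`) give `TwoLegCurveJetBound L M c c′ β U μ K (n+1)`. [cite: BenfattoGiulianiMastropietro2006, §2.4 (2.36)] -/
theorem twoLegCurveJetBound_succ_of_jets {β : ℝ} (hβ : β ≠ 0) (U : ℝ) (n : ℕ)
    (hZ : hubbardEffPartitionFnCT L M β U μ 0 K (klScale klE0 n) ≠ 0) {T : (Fin 2 → ℝ) → ℂ}
    (hT : T = fun P =>
      tadpoleCont β μ K (klScale klE0 (n + 1)) (klScale klE0 n) (klEffectiveAction L M β U μ K klE0 n) P +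
        localReadingCont β
          (gaussConv ℂ (hubbardCovSliceCT L M β μ 0 K (klScale klE0 (n + 1)) (klScale klE0 n)) (klEffectiveAction L M β U μ K klE0 n) -
            klEffectiveAction L M β U μ K klE0 n -
            grassmannLaplacian ℂ (hubbardCovSliceCT L M β μ 0 K (klScale klE0 (n + 1)) (klScale klE0 n))
              (klEffectiveAction L M β U μ K klE0 n)) P +
        localReadingCont β
          (effAction ℂ (hubbardCovSliceCT L M β μ 0 K (klScale klE0 (n + 1)) (klScale klE0 n)) (klEffectiveAction L M β U μ K klE0 n) -
            gaussConv ℂ (hubbardCovSliceCT L M β μ 0 K (klScale klE0 (n + 1)) (klScale klE0 n)) (klEffectiveAction L M β U μ K klE0 n)) P)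
    {c c' : ℕ → ℝ} (hb : ∀ k ≤ 4, ∀ θ : ℝ, |iteratedDeriv k (fun θ' : ℝ => (T (klFermiPoint μ K θ')).re) θ| ≤ curveJetBar c c' U k (n + 1)) :
    TwoLegCurveJetBound L M c c' β U μ K (n + 1) := by
  have hTpoly : IsCharPoly L T := by rw [hT]; exact isCharPoly_incrCont β U n
  exact twoLegCurveJetBound_of_avg8 (klTwoLegCurveProfile_succ_eq_avg8 hβ U n hZ hT)
    (IsCharPoly.contDiff_re_comp_klFermiPoint B hA hADt hlo hhi hTpoly) hb

end Band

end Model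

end Summit.HubbardSuperconductivity.HubbardSuperconductivity.Theorems.C4a

end
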